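import Summits.CriticalPhenomena.PercolationContinuityZ3.Theorems.Transplant.KNCellsProcess
import HarnessLib

/-!
# F8 (generic, LAG-1 ANCHORS), part 1 — the examination with BOTH anchors read from the history: `E_{v,x}`, `Q_x`, `M_x` at `α = arr v`,
# the stubs and targets of `x` at `β = dep v = arr x`; the probe, the replay, validity and the scheme
# (design HOME/prim-bschramm-p2-g2/F8-DESIGN.md §7; supersedes the same-probe departure anchor of `KNCellsScheme`/`KNCellsProcess`)

builds on p205010 (kernel theorem, internal audit signed; external expert review pending) — nothing in this file uses p205010.
Lane `prim-bschramm`, seat `prim-bschramm-p2`; helper file (`--supports stmt-CriticalPhenomena-4575`).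

Why (F8-DESIGN §7): if the stubs `H^j_{x,y}` of the examined vertex `x` are anchored at `x`'s own entry point, read from the pattern of
`E_i ∪ E_{v,x}` revealed in the same probe, then the failure bound (33) needs Kozma–Nitzan's Lemma 12 conditionally on that pattern — and with
`Q_x` frozen Lemma 12 has no randomness for its first target step.  With LAG-1 anchors every set of a probe is a function of the history:
in the probe along `e = (v, δ)` (examining `x = tgt e`) the region `E_{v,x} = Btw ∪ Q_x` and the tested cube `M_x` are anchored at
`α = arr v`, the stubs `H^j_{x,y}`, the far regions `E_{x,y}` and the targets `M_y` of the onward directions at `β = dep v` (which becomes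
`arr x`); the entry anchor of `x`, read off the observation by the re-centring rule relative to `β`, is only STORED as `dep x` for the probes
of `x`'s children.  Then (33) is KN's argument verbatim with the two fixed anchors `(α, β)`.  All two-anchor definitions of `KNCellsScheme`
(`Sx Fj pat Wt Conn cond jOf newRegion baseF seen W₀`) are reused with `(a, a') := (α, β)`.
* §1 `depB`, `succ₂`, `envRegion₂`, `env₂`, `revealOf₂` and their locality;
* §2 `probe₂`, `succ₂_read_iff`, `depB_read`; §3 the replay `astOf₂` (`arr x := dep v`, `dep x := depB …`), `aOf₁`/`aOf₂`, `succ₂'`, `mst_eq_astOf₂`;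
* §4 `Valid₂` (anchored (29), (31), (32) with `α = arr v`, plus `dep v ∈ anchSet (arr v) x`), `nextProbe₂`, **`scheme₂`**, `nextProbe₂_eq_some`,
  `nextProbe₂_of_valid`.
[cite: KozmaNitzan2024, §4 pp. 25–27 (the exploration process) — the ℤ^d model] [cite: GrimmettPercolation1999, §7.2]
-/

noncomputable section

open MeasureTheory ProbabilityTheory
open scoped ENNReal Classical

namespace Summit.CriticalPhenomena.PercolationContinuityZ3.Theorems

namespace Transplant

namespace KNCells

open Literature.Probability.Percolation Literature.Probability.LatticeModels SimpleGraph GadgetSystem ProbeHistory HSiteScheme Contour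

variable {V : Type*} [DecidableEq V]

namespace KSchA

variable {A : Type*} (G : SimpleGraph V) [G.LocallyFinite] (S : KSchA V A)

/-! ## §1 The examination with two history anchors -/

/-- **The stored entry anchor** of the examined vertex `x = tgt e`: the re-centring rule applied, relative to `β` (the anchor of `x`'s own
stubs), to the pattern seen on `E_i ∪ E^α_{v,x}`.  Used only by the probes of `x`'s children. [cite: KozmaNitzan2024, §4 p. 27 (E_{i+1})] -/
def depB (h : ProbeHistory V) (e : Site 2 × MDir) (a a' : A) (o : Finset (Sym2 V)) : A := S.Γ.anchor a' (tgt e) (S.seen G h e a o)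

/-- **Success** with the stubs and targets at the FIXED anchor `a'` ("declare `x` good if all connections to all `y ∈ X` are good").
[cite: KozmaNitzan2024, §4 p. 27] -/
def succ₂ (h : ProbeHistory V) (e : Site 2 × MDir) (a a' : A) (o : Finset (Sym2 V)) : Prop :=
  ∀ du ∈ S.onward G h (tgt e), S.cond G h e a a' du (S.jOf G h e a a' du o) o

/-- The envelope region: `E^α_{v,x}` and the longest stubs at `β`. [cite: KozmaNitzan2024, §4 p. 27] -/
def envRegion₂ (h : ProbeHistory V) (e : Site 2 × MDir) (a a' : A) : Finset V :=
  S.Γ.Ewv a e.1 e.2 ∪ (S.onward G h (tgt e)).biUnion fun du => S.Γ.Stub a' (tgt e) du (S.Γ.K - 1)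

/-- The envelope: the fresh edges of `G` inside `E_i ∪` envelope region. [cite: KozmaNitzan2024, §4 p. 27] -/
def env₂ (h : ProbeHistory V) (e : Site 2 × MDir) (a a' : A) : Finset (Sym2 V) :=
  edgesIn G (S.Vx G h ∪ S.envRegion₂ G h e a a') \ S.F G h

/-- The revealed edges given the observation: the fresh edges of `G` inside `E_i ∪ E^α_{v,x} ∪ ⋃_y H^{j_y, β}_{x,y}`.
[cite: KozmaNitzan2024, §4 p. 27 (E_{i+1})] -/
def revealOf₂ (h : ProbeHistory V) (e : Site 2 × MDir) (a a' : A) (o : Finset (Sym2 V)) : Finset (Sym2 V) :=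
  edgesIn G (S.Vx G h ∪ S.newRegion G h e a a' o) \ S.F G h

variable {G}

/-- The new region lies in the envelope region. [folklore] -/
theorem newRegion_subset_envRegion₂ (h : ProbeHistory V) (e : Site 2 × MDir) (a a' : A) (o : Finset (Sym2 V)) :
    S.newRegion G h e a a' o ⊆ S.envRegion₂ G h e a a' := by
  intro y hy
  rcases Finset.mem_union.1 hy with hy | hy
  · exact Finset.mem_union_left _ hy
  · refine Finset.mem_union_right _ ?_
    rw [Finset.mem_biUnion] at hy ⊢
    obtain ⟨du, hdu, hy⟩ := hy
    exact ⟨du, hdu, S.Γ.stub_mono _ _ _ (by have := S.jOf_lt (G := G) h e a a' du o; omega) hy⟩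

/-- The new edges of `E_i ∪ E_{v,x}` are revealed. [folklore] -/
theorem baseF_sdiff_subset_revealOf₂ (h : ProbeHistory V) (e : Site 2 × MDir) (a a' : A) (o : Finset (Sym2 V)) :
    S.baseF G h e a \ S.F G h ⊆ S.revealOf₂ G h e a a' o := by
  refine Finset.sdiff_subset_sdiff ?_ le_rfl
  intro x hx
  rw [baseF, mem_edgesIn_iff] at hx
  rw [mem_edgesIn_iff]
  refine ⟨hx.1, fun y hy => ?_⟩
  rcases Finset.mem_union.1 (hx.2 y hy) with h' | h'
  · exact Finset.mem_union_left _ h'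
  · exact Finset.mem_union_right _ (S.Ewv_subset_newRegion h e a a' o h')

/-- The revealed edges lie in the envelope. [folklore] -/
theorem revealOf₂_subset_env₂ (h : ProbeHistory V) (e : Site 2 × MDir) (a a' : A) (o : Finset (Sym2 V)) :
    S.revealOf₂ G h e a a' o ⊆ S.env₂ G h e a a' := by
  refine Finset.sdiff_subset_sdiff ?_ le_rfl
  intro x hx
  rw [mem_edgesIn_iff] at hx ⊢
  refine ⟨hx.1, fun y hy => ?_⟩
  rcases Finset.mem_union.1 (hx.2 y hy) with h' | h'
  · exact Finset.mem_union_left _ h'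
  · exact Finset.mem_union_right _ (S.newRegion_subset_envRegion₂ h e a a' o h')

/-- The new conditioned edges at level `j ≤ j_y` of an onward direction are revealed. [folklore] -/
theorem Fj_sdiff_subset_revealOf₂ {h : ProbeHistory V} {e : Site 2 × MDir} {a a' : A} {du : MDir}
    (hdu : du ∈ S.onward G h (tgt e)) {o : Finset (Sym2 V)} {j : ℕ} (hj : j ≤ S.jOf G h e a a' du o) :
    S.Fj G h e a a' du j \ S.F G h ⊆ S.revealOf₂ G h e a a' o := by
  refine Finset.sdiff_subset_sdiff ?_ le_rfl
  intro x hx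
  rw [Fj, mem_edgesIn_iff] at hx
  rw [mem_edgesIn_iff]
  refine ⟨hx.1, fun y hy => ?_⟩
  rcases Finset.mem_union.1 (hx.2 y hy) with h' | h'
  · rcases Finset.mem_union.1 h' with h'' | h''
    · exact Finset.mem_union_left _ h''
    · exact Finset.mem_union_right _ (Finset.mem_union_left _ h'')
  · refine Finset.mem_union_right _ (Finset.mem_union_right _ ?_)
    exact Finset.mem_biUnion.2 ⟨du, hdu, S.Γ.stub_mono _ _ _ hj h'⟩

/-- The new conditioned edges of an onward direction lie in the envelope. [folklore] -/
theorem Fj_sdiff_subset_env₂ (h : ProbeHistory V) (e : Site 2 × MDir) (a a' : A) {du : MDir} (hdu : du ∈ S.onward G h (tgt e))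
    {j : ℕ} (hj : j < S.Γ.K) : S.Fj G h e a a' du j \ S.F G h ⊆ S.env₂ G h e a a' := by
  refine Finset.sdiff_subset_sdiff ?_ le_rfl
  intro x hx
  rw [Fj, mem_edgesIn_iff] at hx
  rw [mem_edgesIn_iff]
  refine ⟨hx.1, fun y hy => ?_⟩
  rcases Finset.mem_union.1 (hx.2 y hy) with h' | h'
  · rcases Finset.mem_union.1 h' with h'' | h''
    · exact Finset.mem_union_left _ h''
    · exact Finset.mem_union_right _ (Finset.mem_union_left _ h'')
  · refine Finset.mem_union_right _ (Finset.mem_union_right _ ?_)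
    exact Finset.mem_biUnion.2 ⟨du, hdu, S.Γ.stub_mono _ _ _ (by omega) h'⟩

/-- **Locality of the stored entry anchor**: observations agreeing on the new edges of `E_i ∪ E_{v,x}` give the same entry anchor. [folklore] -/
theorem depB_congr (h : ProbeHistory V) (e : Site 2 × MDir) (a a' : A) {o o' : Finset (Sym2 V)}
    (hoo' : ∀ x ∈ S.baseF G h e a \ S.F G h, x ∈ o ↔ x ∈ o') : S.depB G h e a a' o' = S.depB G h e a a' o := by
  unfold depB seen
  congr 2; ext x; simp only [Finset.mem_inter]
  exact ⟨fun ⟨hx, hx'⟩ => ⟨(hoo' x hx').2 hx, hx'⟩, fun ⟨hx, hx'⟩ => ⟨(hoo' x hx').1 hx, hx'⟩⟩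

/-- **Locality of `j_y`**: observations agreeing on the revealed edges give the same `j_y` and the same goodness at `j_y`. [folklore] -/
theorem jOf_congr₂ {h : ProbeHistory V} {e : Site 2 × MDir} {a a' : A} {du : MDir} (hdu : du ∈ S.onward G h (tgt e))
    {o o' : Finset (Sym2 V)} (hoo' : ∀ x ∈ S.revealOf₂ G h e a a' o, x ∈ o ↔ x ∈ o') :
    S.jOf G h e a a' du o' = S.jOf G h e a a' du o ∧
      (S.cond G h e a a' du (S.jOf G h e a a' du o) o' ↔ S.cond G h e a a' du (S.jOf G h e a a' du o) o) :=
  S.jOf_congr_of fun _ hj x hx => hoo' x (S.Fj_sdiff_subset_revealOf₂ hdu hj hx)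

/-- **Locality of the revealed set.** [folklore] -/
theorem revealOf₂_congr {h : ProbeHistory V} {e : Site 2 × MDir} {a a' : A} {o o' : Finset (Sym2 V)}
    (hoo' : ∀ x ∈ S.revealOf₂ G h e a a' o, x ∈ o ↔ x ∈ o') : S.revealOf₂ G h e a a' o' = S.revealOf₂ G h e a a' o := by
  unfold revealOf₂ newRegion
  have : ∀ du ∈ S.onward G h (tgt e), S.jOf G h e a a' du o' = S.jOf G h e a a' du o := fun du hdu => (S.jOf_congr₂ hdu hoo').1
  rw [Finset.biUnion_congr rfl fun du hdu => by rw [this du hdu]]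

/-- **Locality of success.** [folklore] -/
theorem succ₂_congr {h : ProbeHistory V} {e : Site 2 × MDir} {a a' : A} {o o' : Finset (Sym2 V)}
    (hoo' : ∀ x ∈ S.revealOf₂ G h e a a' o, x ∈ o ↔ x ∈ o') : S.succ₂ G h e a a' o' ↔ S.succ₂ G h e a a' o := by
  unfold succ₂
  refine forall₂_congr fun du hdu => ?_
  obtain ⟨h1, h2⟩ := S.jOf_congr₂ hdu hoo'
  rw [h1, h2]

/-- Locality of the stored entry anchor under agreement on the revealed edges. [folklore] -/
theorem depB_congr_of_revealOf₂ {h : ProbeHistory V} {e : Site 2 × MDir} {a a' : A} {o o' : Finset (Sym2 V)}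
    (hoo' : ∀ x ∈ S.revealOf₂ G h e a a' o, x ∈ o ↔ x ∈ o') : S.depB G h e a a' o' = S.depB G h e a a' o :=
  S.depB_congr h e a a' fun x hx => hoo' x (S.baseF_sdiff_subset_revealOf₂ h e a a' o hx)

/-! ## §2 The probe -/

variable (G) in
/-- **The adaptive probe of the examination of `x = tgt e` from `v = e.1`** with region anchor `a` and stub anchor `a'`.
[cite: KozmaNitzan2024, §4 p. 27] -/
def probe₂ (h : ProbeHistory V) (e : Site 2 × MDir) (a a' : A) : AProbe V where
  env := S.env₂ G h e a a'
  reveal := fun ω => S.revealOf₂ G h e a a' (obs ω (S.env₂ G h e a a'))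
  reveal_subset := fun ω => S.revealOf₂_subset_env₂ h e a a' _
  reveal_local := by
    intro ω ω' hag
    refine S.revealOf₂_congr fun x hx => ?_
    have hxe : x ∈ S.env₂ G h e a a' := S.revealOf₂_subset_env₂ h e a a' _ hx
    simp only [mem_obs_iff, hxe, true_and]
    exact hag x hx

/-- Success read off the probe's record is success read off the observation of the envelope. [folklore] -/
theorem succ₂_read_iff (h : ProbeHistory V) (e : Site 2 × MDir) (a a' : A) (ω : BondConfig V) :
    S.succ₂ G h e a a' ((S.probe₂ G h e a a').read ω) ↔ S.succ₂ G h e a a' (obs ω (S.env₂ G h e a a')) := by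
  refine S.succ₂_congr fun x hx => ?_
  have hxe : x ∈ S.env₂ G h e a a' := S.revealOf₂_subset_env₂ h e a a' _ hx
  simp only [AProbe.read, probe₂, mem_obs_iff, hxe, hx, true_and]

/-- The stored entry anchor read off the probe's record is the one read off the observation of the envelope. [folklore] -/
theorem depB_read (h : ProbeHistory V) (e : Site 2 × MDir) (a a' : A) (ω : BondConfig V) :
    S.depB G h e a a' ((S.probe₂ G h e a a').read ω) = S.depB G h e a a' (obs ω (S.env₂ G h e a a')) := by
  refine S.depB_congr_of_revealOf₂ fun x hx => ?_
  have hxe : x ∈ S.env₂ G h e a a' := S.revealOf₂_subset_env₂ h e a a' _ hx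
  simp only [AProbe.read, probe₂, mem_obs_iff, hxe, hx, true_and]

/-! ## §3 The replay with lag-1 anchors -/

variable (G) in
/-- **Replay with lag-1 anchors** (newest entry first): a recorded probe is the examination along the chosen edge `e` with region anchor
`arr e.1` and stub anchor `dep e.1`; it occupies the target iff `succ₂` holds, and sets `arr (tgt e) := dep e.1`, `dep (tgt e) :=` the entry
anchor read off the record. [cite: KozmaNitzan2024, §4 pp. 25–27] -/
def astOf₂ : ProbeHistory V → AState A
  | [] => ⟨HSiteScheme.HState.start, fun _ => S.Γ.a₀, fun _ => S.Γ.a₀⟩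
  | none :: h => astOf₂ h
  | some r :: h =>
    match (astOf₂ h).st.choice with
    | none => astOf₂ h
    | some e =>
      ⟨(astOf₂ h).st.update e (S.succ₂ G h e ((astOf₂ h).arr e.1) ((astOf₂ h).dep e.1) r.2),
        Function.update (astOf₂ h).arr (tgt e) ((astOf₂ h).dep e.1),
        Function.update (astOf₂ h).dep (tgt e) (S.depB G h e ((astOf₂ h).arr e.1) ((astOf₂ h).dep e.1) r.2)⟩

variable (G) in
/-- The region anchor of the probe along `e` after `h`: `α = arr e.1`. [folklore] -/
abbrev aOf₁ (h : ProbeHistory V) (e : Site 2 × MDir) : A := (S.astOf₂ G h).arr e.1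

variable (G) in
/-- The stub anchor of the probe along `e` after `h`: `β = dep e.1`. [folklore] -/
abbrev aOf₂ (h : ProbeHistory V) (e : Site 2 × MDir) : A := (S.astOf₂ G h).dep e.1

variable (G) in
/-- **Success** of the probe made after `h` along `e`, reading `o`. [cite: KozmaNitzan2024, §4 p. 27] -/
def succ₂' (h : ProbeHistory V) (e : Site 2 × MDir) (o : Finset (Sym2 V)) : Prop := S.succ₂ G h e (S.aOf₁ G h e) (S.aOf₂ G h e) o

/-- Replay of the empty history. [folklore] -/
@[simp] theorem astOf₂_nil : S.astOf₂ G [] = ⟨HSiteScheme.HState.start, fun _ => S.Γ.a₀, fun _ => S.Γ.a₀⟩ := rfl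

/-- A `none` step does not change the replayed state. [folklore] -/
@[simp] theorem astOf₂_cons_none (h : ProbeHistory V) : S.astOf₂ G (none :: h) = S.astOf₂ G h := rfl

/-- A recorded probe updates the chosen edge, if any, and sets the target's anchors. [folklore] -/
theorem astOf₂_cons_some (r : ProbeRecord V) (h : ProbeHistory V) :
    S.astOf₂ G (some r :: h) = (match (S.astOf₂ G h).st.choice with
      | none => S.astOf₂ G h
      | some e =>
        ⟨(S.astOf₂ G h).st.update e (S.succ₂ G h e ((S.astOf₂ G h).arr e.1) ((S.astOf₂ G h).dep e.1) r.2),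
          Function.update (S.astOf₂ G h).arr (tgt e) ((S.astOf₂ G h).dep e.1),
          Function.update (S.astOf₂ G h).dep (tgt e) (S.depB G h e ((S.astOf₂ G h).arr e.1) ((S.astOf₂ G h).dep e.1) r.2)⟩) := rfl

/-- **The macro-state replayed by the `HSiteScheme` machinery from `succ₂'` is the macro part of the replay.** [folklore] -/
theorem mst_eq_astOf₂ : ∀ h : ProbeHistory V, HSiteScheme.mstOf (S.succ₂' G) h = (S.astOf₂ G h).st
  | [] => rfl
  | none :: h => by rw [HSiteScheme.mstOf_cons_none, astOf₂_cons_none]; exact mst_eq_astOf₂ h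
  | some r :: h => by
    rw [HSiteScheme.mstOf_cons_some, mst_eq_astOf₂ h, astOf₂_cons_some]
    cases (S.astOf₂ G h).st.choice <;> rfl

/-! ## §4 Validity and the scheme -/

variable (G) in
/-- **Valid histories** for the examination along `e` (lag-1 anchors): explored edges = edges inside the explored region, carrying the
pattern; root and the source's column explored; the stub anchor admissible for the region anchor (`dep v ∈ anchSet (arr v) x`); the explored
region inside the cover (cells at `arr`, zones = stubs also at `arr`) of determined macro-vertices missing the target and its onward neighbours;
(32) at the region anchor: `P(root ↔ M^α_x in E_i ∪ E^α_{v,x} | ω|_{E_i}) > 1 - δ`. [cite: KozmaNitzan2024, §4 pp. 26–28 ((29), (31), (32))] -/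
structure Valid₂ (h : ProbeHistory V) (e : Site 2 × MDir) : Prop where
  F_eq : S.F G h = edgesIn G (S.Vx G h)
  ξ_sub : S.ξ G h ⊆ S.F G h
  root_mem : S.Γ.root ∈ S.Vx G h
  src_mem : ∃ y ∈ S.Vx G h, y ∈ S.Γ.col e.1
  anch : S.aOf₂ G h e ∈ S.Γ.anchSet (S.aOf₁ G h e) (tgt e)
  cover : ∃ det : Set (Site 2), tgt e ∉ det ∧ (∀ du ∈ S.onward G h (tgt e), tgt e + stepVec du ∉ det) ∧
    (↑(S.Vx G h) : Set V) ⊆ S.Γ.Cover (S.astOf₂ G h).arr (S.astOf₂ G h).arr det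
  reach : 1 - S.δc < (prodBernoulli (S.W₀ G h e (S.aOf₁ G h e))).real (⋃ t ∈ S.Γ.M (S.aOf₁ G h e) (tgt e), openConn S.Γ.root t)

variable (G) in
/-- The next probe: examine the chosen candidate with the two history anchors, but only after a valid history. [cite: KozmaNitzan2024, §4 p. 27] -/
def nextProbe₂ (h : ProbeHistory V) : Option (AProbe V) :=
  match (S.astOf₂ G h).st.choice with
  | none => none
  | some e => if S.Valid₂ G h e then some (S.probe₂ G h e (S.aOf₁ G h e) (S.aOf₂ G h e)) else none

variable (G) in
/-- **The exploration process with lag-1 anchors** as a history-driven site scheme. [cite: KozmaNitzan2024, §4 pp. 26–27] -/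
def scheme₂ : HSiteScheme V := ⟨⟨S.nextProbe₂ G⟩, S.U₀ G, S.succ₂' G⟩

/-- The scheme's macro-state is the macro part of the replay. [folklore] -/
theorem scheme₂_mst (h : ProbeHistory V) : (S.scheme₂ G).mst h = (S.astOf₂ G h).st := S.mst_eq_astOf₂ h

/-- If a probe is made, the history is valid for the chosen edge and the probe is the two-anchor examination. [folklore] -/
theorem nextProbe₂_eq_some {h : ProbeHistory V} {P : AProbe V} (hP : S.nextProbe₂ G h = some P) :
    ∃ e, (S.astOf₂ G h).st.choice = some e ∧ S.Valid₂ G h e ∧ P = S.probe₂ G h e (S.aOf₁ G h e) (S.aOf₂ G h e) := by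
  unfold nextProbe₂ at hP
  cases hc : (S.astOf₂ G h).st.choice with
  | none => rw [hc] at hP; simp at hP
  | some e =>
    rw [hc] at hP
    simp only at hP
    split_ifs at hP with hV
    rw [Option.some.injEq] at hP
    exact ⟨e, rfl, hV, hP.symm⟩

/-- Conversely a valid history with a candidate is probed. [folklore] -/
theorem nextProbe₂_of_valid {h : ProbeHistory V} {e : Site 2 × MDir}
    (hc : (S.astOf₂ G h).st.choice = some e) (hV : S.Valid₂ G h e) :
    S.nextProbe₂ G h = some (S.probe₂ G h e (S.aOf₁ G h e) (S.aOf₂ G h e)) := by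
  unfold nextProbe₂; rw [hc]; simp only; rw [if_pos hV]

end KSchA

end KNCells

end Transplant

end Summit.CriticalPhenomena.PercolationContinuityZ3.Theorems

end
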